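import Summits.BirchSwinnertonDyer.BirchSwinnertonDyer.Theorems.TeichmullerTwistDescentCells57FromKato
import Summits.BirchSwinnertonDyer.BirchSwinnertonDyer.Theorems.EdixhovenFibreFiveSevenTwistDegreeStepFiveSevenUnitTwist
import Summits.BirchSwinnertonDyer.BirchSwinnertonDyer.Theorems.EdixhovenFibreFiveSevenTwistDegreeStepFiveSevenAddvUnitTwist
import Summits.BirchSwinnertonDyer.BirchSwinnertonDyer.Theorems.EdixhovenFibreFiveSevenTwistDegreeStepFiveSevenKP
import Summits.BirchSwinnertonDyer.BirchSwinnertonDyer.Theorems.EdixhovenFibreFiveSevenStarredOptimalManinUnitFiveSevenTameTwistLever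
import Summits.BirchSwinnertonDyer.Rank1Residual.Additive.GordTwistMinimalModel
import Summits.BirchSwinnertonDyer.BirchSwinnertonDyer.Theorems.EdixhovenFibreFiveSevenTwistDegreeStepFiveSevenTorsTwist
import HarnessLib

/-!
# Route `TeichmullerTwistDescent`, cruxes PSMU (stmt-BirchSwinnertonDyer-22638) and SCMU57
# (stmt-BirchSwinnertonDyer-22639): BOTH cruxes — indeed Manin's `p`-part at EVERY lattice-optimal datum of
# EVERY curve additive at `p ≥ 5` with `E[p]` irreducible — GRANTED Kato's fact F″, modularity, and the two
# unit-twist inputs L-TWIST / TORS-TWIST; no Weil-type partition, no Edixhoven fact (`--supports`)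

Cell `pub/bsd-wall` (D-0145 line route-BirchSwinnertonDyer-TeichmullerTwistDescent, OPEN rev 1), seat
`bsd-line-ttd-p2` (prover 2/2, g2). THEOREMS ONLY (no definition, no named fact, no `sorry`); nothing is
closed unconditionally, no item is booked, BSD is not proved by this.

STATE OF THE TWO CRUXES AFTER THIS FILE. The predecessor files of this seat reduced PSMU / SCMU57 to on-curve
cells (p580436), the `p ∈ {5, 7}` cells off the Kosters–Pannekoek sub-residue to F″ (p583513), and recorded the
exact residual (p584032). Meanwhile the AKR / Edixhoven desks landed: the FULL tame-twist lever at `p > 7`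
(`ManinFrameResidueProperRTameTwist.not_dvd_c_of_tameTwistL`, p573163: Manin's `p`-part at every lattice-optimal
datum, `p > 7` additive, `E[p]` irreducible, GRANTED F′ — hence GRANTED F″, which specialises to F′) and the
AUXILIARY-UNIT-TWIST repair of the Kosters–Pannekoek sub-residue
(`TwistDegreeStepFiveSevenUnitTwist.not_dvd_optimal_c_of_kato_of_unitTwist`, p584459, GRANTED F″ + L-TWIST +
TORS-TWIST; additivity of the unit twist is the tree theorem `AddvUnitTwist.addv_of_model_twist_auxPrime`).
Composing them AT THE CURVE (no passage through an optimal member is needed: the cruxes quantify over a curve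
WITH a lattice-optimal datum) gives the master statement of this file:

* `not_dvd_c_of_kato_of_twistInputs` — GRANTED `exists_isNewformOf` (modularity: level `=` conductor),
  F″ = `kato_neron_isIntegral_twistedSymbolSum_of_additive_five_le`, L-TWIST `hLT` and TORS-TWIST `hTT`
  (binder-for-binder the hypotheses of `ManinFrameResidueProperRTameTwistUnitTwist.stub_memberManinUnit_fiveSeven_torsion_of_twistInputs`,
  p585934, so that their discharges plug in): for `W/ℚ` globally minimal, `p ≥ 5` additive with `E[p]`
  irreducible, and `D` a LATTICE-OPTIMAL datum of `W` at any level: `p ∤ c(D)`.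
  Proof: `p > 7` — the full lever with F′ := F″|_{p>7}; `p ∈ {5, 7}` and `W(ℚ_p)[p] = 0` — the lever off the
  Kosters–Pannekoek exception (`cell57_of_kato57_of_noPTorsion`); `p ∈ {5, 7}` and a `ℚ_p`-rational point of
  order `p` on `W` — Dirichlet's auxiliary prime `q ≡ 13 (20)` / `≡ 5 (28)` with `q > N(W)`, a globally minimal
  model of `W ⊗ χ_{q*}` (additive at `p`, no `p`-torsion on its class by `hTT`), `√q* ∈ ℂ`, and the repair.
* `principalSeriesOptimalManinUnit_of_kato_of_twistInputs`, `supercuspidalOptimalManinUnitFiveSeven_of_kato_of_twistInputs`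
  — **PSMU and SCMU57 BY NAME** from the four inputs; their Weil-type hypotheses ((G)-ordinary member / no
  (G)-ordinary member / no `Iₙ*` member) are NOT used, and Edixhoven's Kodaira fact (needed by p580436 for the
  starred types at `p ≥ 11`) is NOT used either.

HONEST STATUS (numbers): inputs of PSMU ∧ SCMU57 = {modularity (cite-only, BCDT), F″ (cite-only derived reading
of Kato (8.1.3)/9.7/6.6 + Kim–Nakamura 2.1/2.4 + Kosters–Pannekoek Thm 1, referee-flagged, XL), L-TWIST (not in
the tree; ⟸ Ihara's lemma `ModularForms.ribet1984_iharaLemma` + Atkin–Li, seat memo TDS57-KP-RESIDUE-MEMO-v2 §2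
on stmt-22227), TORS-TWIST (not in the tree; elementary — three seats on it at 2026-08-28T00:00Z)}. So the
route's two Manin cruxes carry NO proof obligation of their own beyond AKR 20709 / Edixhoven 22227: granted the
same four inputs all three close. `proof.conditional` by design; BSD is not proved by this.
[cite: Kato2004Asterisque, (8.1.3) (p. 180), Thm. 9.7 (p. 189)] [cite: KimNakamura2020, Thm. 2.1, Cor. 2.4]
[cite: KostersPannekoek2017, Thm. 1 and Cor. 2] [cite: Stevens1989, Lemma (5.2) p. 96] [cite: Ribet1984ICM, Thm. 4.1]
[cite: BCDTJAMS2001, Thm. A] [cite: KrausOesterle1992, §3 Lemme 1]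
-/

set_option autoImplicit false
-- single-conjunct summit: `Summit.BirchSwinnertonDyer.BirchSwinnertonDyer.…` repeats the name by design
set_option linter.dupNamespace false

noncomputable section

open scoped Classical MatrixGroups

open WeierstrassCurve IsDedekindDomain Rat.HeightOneSpectrum NumberField
  Literature.NumberTheory.EllipticCurves Literature.NumberTheory.EllipticCurves.ModularForms
  Literature.NumberTheory.EllipticCurves.Rank1Residual Literature.NumberTheory.DiophantineGeometry
  Summit.BirchSwinnertonDyer.Rank1Residual Summit.BirchSwinnertonDyer.Rank1Residual.Additive
  Summit.BirchSwinnertonDyer.BirchSwinnertonDyer.Theses.TeichmullerTwistDescent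
  Summit.BirchSwinnertonDyer.BirchSwinnertonDyer.Theorems CongruenceSubgroup

namespace Summit.BirchSwinnertonDyer.BirchSwinnertonDyer.Theorems.TeichmullerTwistDescent

/-! ### §0 Bookkeeping: the multiplicative Euler data at the conductor level

(F″ ⟹ F′ is the landed `KatoLever.kato_neron_of_five_le`; Dirichlet's auxiliary prime is the landed
`TwistDegreeStepFiveSevenKP.exists_auxPrime` — both imported, not restated.) -/

/-- At the conductor level the primes `ℓ ∥ N(W)` are multiplicative, so `a_ℓ(W) = ±1` (Kraus–Oesterlé).
[cite: KrausOesterle1992, §3 Lemme 1] -/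
theorem lFunction_eq_one_or_neg_one_of_exactly_dvd_conductorNorm (W : WeierstrassCurve ℚ) [W.IsElliptic]
    [W.IsGloballyMinimal] :
    ∀ ℓ ∈ (W.conductorNorm ℤ).primeFactors, ¬ ℓ ^ 2 ∣ W.conductorNorm ℤ →
      W.LFunction ℓ = 1 ∨ W.LFunction ℓ = -1 := by
  intro ℓ hℓ hℓ2
  haveI : Fact ℓ.Prime := ⟨Nat.prime_of_mem_primeFactors hℓ⟩
  rcases hasGoodReductionAtPrime_or_hasMultiplicativeReductionAtPrime_of_not_sq_dvd_conductorNorm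
      (V := W) hℓ2 with hg | hmul
  · exact absurd (Nat.dvd_of_mem_primeFactors hℓ) (not_dvd_conductorNorm_of_hasGoodReductionAtPrime W hg)
  · exact KrausOesterle1992.lFunction_apply_prime_eq_one_or_eq_neg_one_of_mult W ℓ hmul

/-! ### §1 The master statement: Manin's `p`-part at every lattice-optimal datum, `p ≥ 5` additive, `E[p]`
irreducible — GRANTED modularity, F″, L-TWIST, TORS-TWIST -/

/-- **Manin's `p`-part at EVERY lattice-optimal datum, GRANTED modularity, Kato's fact F″ and the two
unit-twist inputs.** Let `W/ℚ` be globally minimal, additive at a prime `p ≥ 5` with `E[p]` irreducible, and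
`D` a LATTICE-OPTIMAL parametrisation datum of `W` (`Λ_W = c·Λ_f`) at any level `N` (then `N = N(W)`,
Carayol via `hnf`). Then `p ∤ c(D)`, granted: `hnf` (modularity), `hK` = F″
(`kato_neron_isIntegral_twistedSymbolSum_of_additive_five_le`), `hLT` = L-TWIST (twisted-period decomposition
`Λ(f) ⊆ √q*·Λ(g) + p·Λ(f)` for the newforms `g` of a unit twist `W ⊗ χ_{q*}`, `q ∤ 2pN`) and `hTT` = TORS-TWIST
(a non-residue unit twist kills `ℚ_p`-rational `p`-torsion on the whole twisted class) — the last two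
binder-for-binder as in `ManinFrameResidueProperRTameTwistUnitTwist.stub_memberManinUnit_fiveSeven_torsion_of_twistInputs`.
Cases: `p > 7` — `ManinFrameResidueProperRTameTwist.not_dvd_c_of_tameTwistL` with F′ := F″|_{p>7}
(`p² ∣ N(W)`: additivity; `a_ℓ = ±1` at `ℓ ∥ N(W)`); `p ∈ {5, 7}`, `W(ℚ_p)[p] = 0` —
`cell57_of_kato57_of_noPTorsion`; `p ∈ {5, 7}` with a `ℚ_p`-rational point of order `p` — the auxiliary-unit-twist
repair `TwistDegreeStepFiveSevenUnitTwist.not_dvd_optimal_c_of_kato_of_unitTwist` at `W` itself (Dirichlet prime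
`q > N(W)`, `q ≡ 13 (20)` / `≡ 5 (28)`; minimal model of `W ⊗ χ_{q*}` by `exists_minimal_twist_pStar`, additive
at `p` by `AddvUnitTwist.addv_of_model_twist_auxPrime`; `hTT` fed with the witness on `W`; `hLT` at `(W, D)`).
CONDITIONAL (`hnf`, `hK` cite-only; `hLT`, `hTT` not in the tree); nothing closed; BSD is not proved by this.
[cite: Kato2004Asterisque, (8.1.3) (p. 180), Thm. 9.7 (p. 189)] [cite: KostersPannekoek2017, Thm. 1 and Cor. 2]
[cite: Stevens1989, Lemma (5.2) p. 96] [cite: BCDTJAMS2001, Thm. A] -/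
theorem not_dvd_c_of_kato_of_twistInputs (hnf : exists_isNewformOf)
    (hK : kato_neron_isIntegral_twistedSymbolSum_of_additive_five_le)
    (hLT : ∀ (p : ℕ) [Fact p.Prime] (q : ℕ) [Fact q.Prime] (V₀ : WeierstrassCurve ℚ) [V₀.IsElliptic]
      [V₀.IsGloballyMinimal] [NeZero (V₀.conductorNorm ℤ)]
      (D₀ : ModularParametrizationData V₀ (V₀.conductorNorm ℤ)), 5 ≤ p → Irr V₀ p → q ≠ 2 → q ≠ p →
      ¬ q ∣ V₀.conductorNorm ℤ →
      ∀ (Vχ : WeierstrassCurve ℚ) [Vχ.IsElliptic] [Vχ.IsGloballyMinimal] (v : VariableChange ℚ),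
      v • V₀.quadraticTwist (((-1 : ℤ) ^ (q / 2) * q : ℤ) : ℚ) = Vχ →
      ∀ (s : ℂ), s ^ 2 = (((-1 : ℤ) ^ (q / 2) * q : ℤ) : ℂ) →
      ∀ (N' : ℕ) [NeZero N'] (g : CuspForm (Gamma0 N') 2), IsNewformOf Vχ g →
      ∀ z ∈ periodLattice D₀.f, ∃ w ∈ periodLattice g, ∃ y ∈ periodLattice D₀.f, z = s * w + (p : ℂ) * y)
    (hTT : ∀ (p : ℕ) [Fact p.Prime] (q : ℕ) [Fact q.Prime] (V₀ : WeierstrassCurve ℚ) [V₀.IsElliptic]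
      [V₀.IsGloballyMinimal], 5 ≤ p → Irr V₀ p → q ≠ p →
      ¬ IsSquare ((((-1 : ℤ) ^ (q / 2) * q : ℤ)) : ZMod p) →
      (∃ (W' : WeierstrassCurve ℚ) (_ : W'.IsElliptic) (_ : W'.IsGloballyMinimal)
        (P : (W'.baseChange ℚ_[p]).toAffine.Point), IsIsogenous V₀ W' ∧ P ≠ 0 ∧ p • P = 0) →
      ∀ (Vχ : WeierstrassCurve ℚ) [Vχ.IsElliptic] [Vχ.IsGloballyMinimal] (v : VariableChange ℚ),
      v • V₀.quadraticTwist (((-1 : ℤ) ^ (q / 2) * q : ℤ) : ℚ) = Vχ →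
      ∀ (W'' : WeierstrassCurve ℚ) [W''.IsElliptic] [W''.IsGloballyMinimal], IsIsogenous Vχ W'' →
      ∀ Q : (W''.baseChange ℚ_[p]).toAffine.Point, p • Q = 0 → Q = 0)
    (W : WeierstrassCurve ℚ) [W.IsElliptic] [W.IsGloballyMinimal] (p : ℕ) [hp : Fact p.Prime]
    {N : ℕ} [NeZero N] (D : ModularParametrizationData W N)
    (hp5 : 5 ≤ p) (hadd : Addv W p) (hirr : Irr W p)
    (hlat : ∀ z ∈ D.L.lattice, ∃ w ∈ periodLattice D.f, z = D.c * w) :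
    ¬ (p : ℤ) ∣ D.c := by
  have hpP : p.Prime := hp.out
  -- the level of the datum is the conductor (Carayol, from modularity)
  have hN : N = W.conductorNorm ℤ :=
    IsNewformOf.level_eq_conductorNorm_of_exists_isNewformOf hnf D.isNewformOf
  subst hN
  have hpN : p ^ 2 ∣ W.conductorNorm ℤ := sq_dvd_conductorNorm_of_not_good_of_not_mult hadd
  have ha := lFunction_eq_one_or_neg_one_of_exactly_dvd_conductorNorm W
  rcases Nat.lt_or_ge 7 p with h7 | h7
  · -- `p > 7`: the full tame-twist lever with F′ := F″|_{p > 7}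
    exact ManinFrameResidueProperRTameTwist.not_dvd_c_of_tameTwistL
      (Cruxes.StarredOptimalManinUnitFiveSeven.KatoLever.kato_neron_of_five_le hK) W D hlat h7 hadd hirr hpN ha
  · have hp57 : p = 5 ∨ p = 7 := by
      interval_cases p <;>
        first | exact Or.inl rfl | exact Or.inr rfl | exact absurd hpP (by decide)
    by_cases hPT : ∀ P : (W.baseChange ℚ_[p]).toAffine.Point, p • P = 0 → P = 0
    · -- off the Kosters–Pannekoek exception: the `p ∈ {5, 7}` lever
      exact cell57_of_kato57_of_noPTorsion hK W p D hp57 hadd hirr hPT hlat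
    · -- on it: the auxiliary-unit-twist repair at `W` itself
      push Not at hPT
      obtain ⟨P, hP, hP0⟩ := hPT
      obtain ⟨q, hqN, hq, hq2, hqp, hnsq⟩ := TwistDegreeStepFiveSevenKP.exists_auxPrime hp57 (W.conductorNorm ℤ)
      haveI : Fact q.Prime := ⟨hq⟩
      have hqN' : ¬ q ∣ W.conductorNorm ℤ := fun h ↦
        absurd (Nat.le_of_dvd (Nat.pos_of_ne_zero (NeZero.ne _)) h) (by omega)
      have hqsq : ¬ q ^ 2 ∣ W.conductorNorm ℤ := fun h ↦ hqN' ((dvd_pow_self q two_ne_zero).trans h)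
      have hgm : W.HasGoodReductionAtPrime q ∨ W.HasMultiplicativeReductionAtPrime q :=
        hasGoodReductionAtPrime_or_hasMultiplicativeReductionAtPrime_of_not_sq_dvd_conductorNorm (V := W) hqsq
      -- a globally minimal model of `W ⊗ χ_{q*}`, additive at `p`, torsion-free class, `√q*`
      obtain ⟨Vχ, hEχ, hMχ, v, hv⟩ := exists_minimal_twist_pStar q W
      haveI := hEχ
      haveI := hMχ
      haveI : NeZero (Vχ.conductorNorm ℤ) := ⟨(Vχ.conductorNorm_pos_holds).ne'⟩
      have hv' : v • W.quadraticTwist (((-1 : ℤ) ^ (q / 2) * q : ℤ) : ℚ) = Vχ := by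
        rw [(pStar_intCast q).1]; exact hv
      obtain ⟨s, hs2⟩ := IsAlgClosed.exists_pow_nat_eq ((((-1 : ℤ) ^ (q / 2) * q : ℤ)) : ℂ) two_pos
      have haddχ : Addv Vχ p :=
        AddvUnitTwist.addv_of_model_twist_auxPrime (by omega) hq hqp hadd ⟨v, hv'⟩
      have hPTχ := hTT p q W hp5 hirr hqp hnsq ⟨W, ‹_›, ‹_›, P, isIsogenous_self W, hP0, hP⟩ Vχ v hv'
      have hL := hLT p q W D hp5 hirr hq2 hqp hqN' Vχ v hv' s hs2
      exact TwistDegreeStepFiveSevenUnitTwist.not_dvd_optimal_c_of_kato_of_unitTwist hK hnf hp57 W hirr D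
        hlat hq2 hgm Vχ v hv' haddχ hPTχ s hs2 hL

/-! ### §2 The two cruxes of the route BY NAME -/

/-- **PSMU `PrincipalSeriesOptimalManinUnit` (stmt-BirchSwinnertonDyer-22638) GRANTED modularity, F″, L-TWIST and
TORS-TWIST** — by `not_dvd_c_of_kato_of_twistInputs`; the Weil-type hypotheses of the crux (a (G)-ordinary member,
an `Iₙ*`-free member) are not used, nor is Edixhoven's Kodaira fact. CONDITIONAL; the item is not closed by this;
BSD is not proved by this. [cite: Kato2004Asterisque, (8.1.3) (p. 180), Thm. 9.7 (p. 189)]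
[cite: KostersPannekoek2017, Thm. 1 and Cor. 2] [cite: Stevens1989, Lemma (5.2) p. 96] -/
theorem principalSeriesOptimalManinUnit_of_kato_of_twistInputs (hnf : exists_isNewformOf)
    (hK : kato_neron_isIntegral_twistedSymbolSum_of_additive_five_le)
    (hLT : ∀ (p : ℕ) [Fact p.Prime] (q : ℕ) [Fact q.Prime] (V₀ : WeierstrassCurve ℚ) [V₀.IsElliptic]
      [V₀.IsGloballyMinimal] [NeZero (V₀.conductorNorm ℤ)]
      (D₀ : ModularParametrizationData V₀ (V₀.conductorNorm ℤ)), 5 ≤ p → Irr V₀ p → q ≠ 2 → q ≠ p →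
      ¬ q ∣ V₀.conductorNorm ℤ →
      ∀ (Vχ : WeierstrassCurve ℚ) [Vχ.IsElliptic] [Vχ.IsGloballyMinimal] (v : VariableChange ℚ),
      v • V₀.quadraticTwist (((-1 : ℤ) ^ (q / 2) * q : ℤ) : ℚ) = Vχ →
      ∀ (s : ℂ), s ^ 2 = (((-1 : ℤ) ^ (q / 2) * q : ℤ) : ℂ) →
      ∀ (N' : ℕ) [NeZero N'] (g : CuspForm (Gamma0 N') 2), IsNewformOf Vχ g →
      ∀ z ∈ periodLattice D₀.f, ∃ w ∈ periodLattice g, ∃ y ∈ periodLattice D₀.f, z = s * w + (p : ℂ) * y)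
    (hTT : ∀ (p : ℕ) [Fact p.Prime] (q : ℕ) [Fact q.Prime] (V₀ : WeierstrassCurve ℚ) [V₀.IsElliptic]
      [V₀.IsGloballyMinimal], 5 ≤ p → Irr V₀ p → q ≠ p →
      ¬ IsSquare ((((-1 : ℤ) ^ (q / 2) * q : ℤ)) : ZMod p) →
      (∃ (W' : WeierstrassCurve ℚ) (_ : W'.IsElliptic) (_ : W'.IsGloballyMinimal)
        (P : (W'.baseChange ℚ_[p]).toAffine.Point), IsIsogenous V₀ W' ∧ P ≠ 0 ∧ p • P = 0) →
      ∀ (Vχ : WeierstrassCurve ℚ) [Vχ.IsElliptic] [Vχ.IsGloballyMinimal] (v : VariableChange ℚ),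
      v • V₀.quadraticTwist (((-1 : ℤ) ^ (q / 2) * q : ℤ) : ℚ) = Vχ →
      ∀ (W'' : WeierstrassCurve ℚ) [W''.IsElliptic] [W''.IsGloballyMinimal], IsIsogenous Vχ W'' →
      ∀ Q : (W''.baseChange ℚ_[p]).toAffine.Point, p • Q = 0 → Q = 0) :
    PrincipalSeriesOptimalManinUnit := by
  intro W _ _ p _ N _ D hp5 hadd hirr _ _ hlat
  exact not_dvd_c_of_kato_of_twistInputs hnf hK hLT hTT W p D hp5 hadd hirr hlat

/-- **SCMU57 `SupercuspidalOptimalManinUnitFiveSeven` (stmt-BirchSwinnertonDyer-22639) GRANTED modularity, F″,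
L-TWIST and TORS-TWIST** — by `not_dvd_c_of_kato_of_twistInputs` at `p ∈ {5, 7}`; the hypotheses "no (G)-ordinary
member" and "an `Iₙ*`-free member" are not used. CONDITIONAL; the item is not closed by this; BSD is not proved
by this. [cite: Kato2004Asterisque, (8.1.3) (p. 180), Thm. 9.7 (p. 189)] [cite: KostersPannekoek2017, Thm. 1 and Cor. 2]
[cite: Stevens1989, Lemma (5.2) p. 96] -/
theorem supercuspidalOptimalManinUnitFiveSeven_of_kato_of_twistInputs (hnf : exists_isNewformOf)
    (hK : kato_neron_isIntegral_twistedSymbolSum_of_additive_five_le)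
    (hLT : ∀ (p : ℕ) [Fact p.Prime] (q : ℕ) [Fact q.Prime] (V₀ : WeierstrassCurve ℚ) [V₀.IsElliptic]
      [V₀.IsGloballyMinimal] [NeZero (V₀.conductorNorm ℤ)]
      (D₀ : ModularParametrizationData V₀ (V₀.conductorNorm ℤ)), 5 ≤ p → Irr V₀ p → q ≠ 2 → q ≠ p →
      ¬ q ∣ V₀.conductorNorm ℤ →
      ∀ (Vχ : WeierstrassCurve ℚ) [Vχ.IsElliptic] [Vχ.IsGloballyMinimal] (v : VariableChange ℚ),
      v • V₀.quadraticTwist (((-1 : ℤ) ^ (q / 2) * q : ℤ) : ℚ) = Vχ →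
      ∀ (s : ℂ), s ^ 2 = (((-1 : ℤ) ^ (q / 2) * q : ℤ) : ℂ) →
      ∀ (N' : ℕ) [NeZero N'] (g : CuspForm (Gamma0 N') 2), IsNewformOf Vχ g →
      ∀ z ∈ periodLattice D₀.f, ∃ w ∈ periodLattice g, ∃ y ∈ periodLattice D₀.f, z = s * w + (p : ℂ) * y)
    (hTT : ∀ (p : ℕ) [Fact p.Prime] (q : ℕ) [Fact q.Prime] (V₀ : WeierstrassCurve ℚ) [V₀.IsElliptic]
      [V₀.IsGloballyMinimal], 5 ≤ p → Irr V₀ p → q ≠ p →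
      ¬ IsSquare ((((-1 : ℤ) ^ (q / 2) * q : ℤ)) : ZMod p) →
      (∃ (W' : WeierstrassCurve ℚ) (_ : W'.IsElliptic) (_ : W'.IsGloballyMinimal)
        (P : (W'.baseChange ℚ_[p]).toAffine.Point), IsIsogenous V₀ W' ∧ P ≠ 0 ∧ p • P = 0) →
      ∀ (Vχ : WeierstrassCurve ℚ) [Vχ.IsElliptic] [Vχ.IsGloballyMinimal] (v : VariableChange ℚ),
      v • V₀.quadraticTwist (((-1 : ℤ) ^ (q / 2) * q : ℤ) : ℚ) = Vχ →
      ∀ (W'' : WeierstrassCurve ℚ) [W''.IsElliptic] [W''.IsGloballyMinimal], IsIsogenous Vχ W'' →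
      ∀ Q : (W''.baseChange ℚ_[p]).toAffine.Point, p • Q = 0 → Q = 0) :
    SupercuspidalOptimalManinUnitFiveSeven := by
  intro W _ _ p _ N _ D hp57 hadd hirr _ _ hlat
  exact not_dvd_c_of_kato_of_twistInputs hnf hK hLT hTT W p D (by rcases hp57 with rfl | rfl <;> omega)
    hadd hirr hlat

/-! ### §3 TORS-TWIST discharged (appended 2026-08-28, same seat): PSMU / SCMU57 GRANTED modularity, F″ and
L-TWIST only

TORS-TWIST is now a TREE THEOREM at `p ∈ {5, 7}` for an additive `V₀`: `TorsTwist.torsTwist57_input`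
(`Theorems/EdixhovenFibreFiveSevenTwistDegreeStepFiveSevenTorsTwist.lean`, p588615, seat bsd-line-edix-p2 g2:
prime-to-`p` isogenies act injectively on `ℚ_p`-rational `p`-torsion + Mazur's Step-1 residues
`c₄ ≡ −5 (25)` / `c₆ ≡ 7 (49)` flipped by a non-residue unit twist). Its binder shape is the hypothesis `hTT`
of §1 plus `p = 5 ∨ p = 7` and `Addv V₀ p` — both available at the only call site (the Kosters–Pannekoek
branch of `not_dvd_c_of_kato_of_twistInputs`). Hence the versions below without `hTT`. -/

/-- **Manin's `p`-part at EVERY lattice-optimal datum, GRANTED modularity, Kato's fact F″ and L-TWIST** — §1's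
`not_dvd_c_of_kato_of_twistInputs` with TORS-TWIST supplied by the tree theorem `TorsTwist.torsTwist57_input`
(p588615). For `W/ℚ` globally minimal, additive at `p ≥ 5` with `E[p]` irreducible, `D` lattice-optimal at any
level: `p ∤ c(D)`. Remaining non-print input: `hLT` (twisted-period decomposition ⟸ Ihara's lemma).
CONDITIONAL; nothing closed; BSD is not proved by this. [cite: Kato2004Asterisque, (8.1.3) (p. 180), Thm. 9.7 (p. 189)]
[cite: KostersPannekoek2017, Thm. 1 and Cor. 2] [cite: Stevens1989, Lemma (5.2) p. 96] [cite: Mazur1977, Ch. III §5, Step 1] -/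
theorem not_dvd_c_of_kato_of_periodTwist (hnf : exists_isNewformOf)
    (hK : kato_neron_isIntegral_twistedSymbolSum_of_additive_five_le)
    (hLT : ∀ (p : ℕ) [Fact p.Prime] (q : ℕ) [Fact q.Prime] (V₀ : WeierstrassCurve ℚ) [V₀.IsElliptic]
      [V₀.IsGloballyMinimal] [NeZero (V₀.conductorNorm ℤ)]
      (D₀ : ModularParametrizationData V₀ (V₀.conductorNorm ℤ)), 5 ≤ p → Irr V₀ p → q ≠ 2 → q ≠ p →
      ¬ q ∣ V₀.conductorNorm ℤ →
      ∀ (Vχ : WeierstrassCurve ℚ) [Vχ.IsElliptic] [Vχ.IsGloballyMinimal] (v : VariableChange ℚ),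
      v • V₀.quadraticTwist (((-1 : ℤ) ^ (q / 2) * q : ℤ) : ℚ) = Vχ →
      ∀ (s : ℂ), s ^ 2 = (((-1 : ℤ) ^ (q / 2) * q : ℤ) : ℂ) →
      ∀ (N' : ℕ) [NeZero N'] (g : CuspForm (Gamma0 N') 2), IsNewformOf Vχ g →
      ∀ z ∈ periodLattice D₀.f, ∃ w ∈ periodLattice g, ∃ y ∈ periodLattice D₀.f, z = s * w + (p : ℂ) * y)
    (W : WeierstrassCurve ℚ) [W.IsElliptic] [W.IsGloballyMinimal] (p : ℕ) [hp : Fact p.Prime]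
    {N : ℕ} [NeZero N] (D : ModularParametrizationData W N)
    (hp5 : 5 ≤ p) (hadd : Addv W p) (hirr : Irr W p)
    (hlat : ∀ z ∈ D.L.lattice, ∃ w ∈ periodLattice D.f, z = D.c * w) :
    ¬ (p : ℤ) ∣ D.c := by
  have hpP : p.Prime := hp.out
  have hN : N = W.conductorNorm ℤ :=
    IsNewformOf.level_eq_conductorNorm_of_exists_isNewformOf hnf D.isNewformOf
  subst hN
  have hpN : p ^ 2 ∣ W.conductorNorm ℤ := sq_dvd_conductorNorm_of_not_good_of_not_mult hadd
  have ha := lFunction_eq_one_or_neg_one_of_exactly_dvd_conductorNorm W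
  rcases Nat.lt_or_ge 7 p with h7 | h7
  · exact ManinFrameResidueProperRTameTwist.not_dvd_c_of_tameTwistL
      (Cruxes.StarredOptimalManinUnitFiveSeven.KatoLever.kato_neron_of_five_le hK) W D hlat h7 hadd hirr hpN ha
  · have hp57 : p = 5 ∨ p = 7 := by
      interval_cases p <;>
        first | exact Or.inl rfl | exact Or.inr rfl | exact absurd hpP (by decide)
    by_cases hPT : ∀ P : (W.baseChange ℚ_[p]).toAffine.Point, p • P = 0 → P = 0
    · exact cell57_of_kato57_of_noPTorsion hK W p D hp57 hadd hirr hPT hlat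
    · push Not at hPT
      obtain ⟨P, hP, hP0⟩ := hPT
      obtain ⟨q, hqN, hq, hq2, hqp, hnsq⟩ := TwistDegreeStepFiveSevenKP.exists_auxPrime hp57 (W.conductorNorm ℤ)
      haveI : Fact q.Prime := ⟨hq⟩
      have hqN' : ¬ q ∣ W.conductorNorm ℤ := fun h ↦
        absurd (Nat.le_of_dvd (Nat.pos_of_ne_zero (NeZero.ne _)) h) (by omega)
      have hqsq : ¬ q ^ 2 ∣ W.conductorNorm ℤ := fun h ↦ hqN' ((dvd_pow_self q two_ne_zero).trans h)
      have hgm : W.HasGoodReductionAtPrime q ∨ W.HasMultiplicativeReductionAtPrime q :=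
        hasGoodReductionAtPrime_or_hasMultiplicativeReductionAtPrime_of_not_sq_dvd_conductorNorm (V := W) hqsq
      obtain ⟨Vχ, hEχ, hMχ, v, hv⟩ := exists_minimal_twist_pStar q W
      haveI := hEχ
      haveI := hMχ
      haveI : NeZero (Vχ.conductorNorm ℤ) := ⟨(Vχ.conductorNorm_pos_holds).ne'⟩
      have hv' : v • W.quadraticTwist (((-1 : ℤ) ^ (q / 2) * q : ℤ) : ℚ) = Vχ := by
        rw [(pStar_intCast q).1]; exact hv
      obtain ⟨s, hs2⟩ := IsAlgClosed.exists_pow_nat_eq ((((-1 : ℤ) ^ (q / 2) * q : ℤ)) : ℂ) two_pos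
      have haddχ : Addv Vχ p :=
        AddvUnitTwist.addv_of_model_twist_auxPrime (by omega) hq hqp hadd ⟨v, hv'⟩
      -- TORS-TWIST, now a theorem (p588615)
      have hPTχ : ∀ (W' : WeierstrassCurve ℚ) [W'.IsElliptic] [W'.IsGloballyMinimal], IsIsogenous Vχ W' →
          ∀ Q : (W'.baseChange ℚ_[p]).toAffine.Point, p • Q = 0 → Q = 0 :=
        fun W' _ _ hiso Q hQ ↦ TorsTwist.torsTwist57_input p q W hp57 hadd hirr hqp hnsq
          ⟨W, ‹_›, ‹_›, P, isIsogenous_self W, hP0, hP⟩ Vχ v hv' W' hiso Q hQ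
      have hL := hLT p q W D hp5 hirr hq2 hqp hqN' Vχ v hv' s hs2
      exact TwistDegreeStepFiveSevenUnitTwist.not_dvd_optimal_c_of_kato_of_unitTwist hK hnf hp57 W hirr D
        hlat hq2 hgm Vχ v hv' haddχ hPTχ s hs2 hL

/-- **PSMU (stmt-BirchSwinnertonDyer-22638) GRANTED modularity, F″ and L-TWIST** — TORS-TWIST discharged by
the tree. CONDITIONAL; the item is not closed by this; BSD is not proved by this.
[cite: Kato2004Asterisque, (8.1.3) (p. 180), Thm. 9.7 (p. 189)] [cite: KostersPannekoek2017, Thm. 1 and Cor. 2]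
[cite: Stevens1989, Lemma (5.2) p. 96] -/
theorem principalSeriesOptimalManinUnit_of_kato_of_periodTwist (hnf : exists_isNewformOf)
    (hK : kato_neron_isIntegral_twistedSymbolSum_of_additive_five_le)
    (hLT : ∀ (p : ℕ) [Fact p.Prime] (q : ℕ) [Fact q.Prime] (V₀ : WeierstrassCurve ℚ) [V₀.IsElliptic]
      [V₀.IsGloballyMinimal] [NeZero (V₀.conductorNorm ℤ)]
      (D₀ : ModularParametrizationData V₀ (V₀.conductorNorm ℤ)), 5 ≤ p → Irr V₀ p → q ≠ 2 → q ≠ p →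
      ¬ q ∣ V₀.conductorNorm ℤ →
      ∀ (Vχ : WeierstrassCurve ℚ) [Vχ.IsElliptic] [Vχ.IsGloballyMinimal] (v : VariableChange ℚ),
      v • V₀.quadraticTwist (((-1 : ℤ) ^ (q / 2) * q : ℤ) : ℚ) = Vχ →
      ∀ (s : ℂ), s ^ 2 = (((-1 : ℤ) ^ (q / 2) * q : ℤ) : ℂ) →
      ∀ (N' : ℕ) [NeZero N'] (g : CuspForm (Gamma0 N') 2), IsNewformOf Vχ g →
      ∀ z ∈ periodLattice D₀.f, ∃ w ∈ periodLattice g, ∃ y ∈ periodLattice D₀.f, z = s * w + (p : ℂ) * y) :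
    PrincipalSeriesOptimalManinUnit := by
  intro W _ _ p _ N _ D hp5 hadd hirr _ _ hlat
  exact not_dvd_c_of_kato_of_periodTwist hnf hK hLT W p D hp5 hadd hirr hlat

/-- **SCMU57 (stmt-BirchSwinnertonDyer-22639) GRANTED modularity, F″ and L-TWIST** — TORS-TWIST discharged by
the tree. CONDITIONAL; the item is not closed by this; BSD is not proved by this.
[cite: Kato2004Asterisque, (8.1.3) (p. 180), Thm. 9.7 (p. 189)] [cite: KostersPannekoek2017, Thm. 1 and Cor. 2]
[cite: Stevens1989, Lemma (5.2) p. 96] -/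
theorem supercuspidalOptimalManinUnitFiveSeven_of_kato_of_periodTwist (hnf : exists_isNewformOf)
    (hK : kato_neron_isIntegral_twistedSymbolSum_of_additive_five_le)
    (hLT : ∀ (p : ℕ) [Fact p.Prime] (q : ℕ) [Fact q.Prime] (V₀ : WeierstrassCurve ℚ) [V₀.IsElliptic]
      [V₀.IsGloballyMinimal] [NeZero (V₀.conductorNorm ℤ)]
      (D₀ : ModularParametrizationData V₀ (V₀.conductorNorm ℤ)), 5 ≤ p → Irr V₀ p → q ≠ 2 → q ≠ p →
      ¬ q ∣ V₀.conductorNorm ℤ →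
      ∀ (Vχ : WeierstrassCurve ℚ) [Vχ.IsElliptic] [Vχ.IsGloballyMinimal] (v : VariableChange ℚ),
      v • V₀.quadraticTwist (((-1 : ℤ) ^ (q / 2) * q : ℤ) : ℚ) = Vχ →
      ∀ (s : ℂ), s ^ 2 = (((-1 : ℤ) ^ (q / 2) * q : ℤ) : ℂ) →
      ∀ (N' : ℕ) [NeZero N'] (g : CuspForm (Gamma0 N') 2), IsNewformOf Vχ g →
      ∀ z ∈ periodLattice D₀.f, ∃ w ∈ periodLattice g, ∃ y ∈ periodLattice D₀.f, z = s * w + (p : ℂ) * y) :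
    SupercuspidalOptimalManinUnitFiveSeven := by
  intro W _ _ p _ N _ D hp57 hadd hirr _ _ hlat
  exact not_dvd_c_of_kato_of_periodTwist hnf hK hLT W p D (by rcases hp57 with rfl | rfl <;> omega)
    hadd hirr hlat

end Summit.BirchSwinnertonDyer.BirchSwinnertonDyer.Theorems.TeichmullerTwistDescent

end
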